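/-
Copyright: cell pub-balaban-gaps (YM BLITZ Y1, track G1), seat g1-p2 GEN 9 (unit `pub-balaban-gaps-g1-p2`).  Row (D4) NODE O,
OBJECT level, the HOLOMORPHY DICTIONARY for the exponential presentation `U = e^{X}` of print's (3.37): the transporter entries
`u ↦ (e^{±X(u)})_{ab}` are holomorphic on a ball as soon as the entries `u ↦ X(u)_{ab}` are — so that the Cor. 3.5 steps for
`U = e^{X}` (`D4WalkBlockExpTransport`, and the staged multi-level `D4WalkBlockCovariantExpFieldMultiLevel`) may take holomorphy
of `X` instead of holomorphy of `e^{±X}` as data.  Pure finite-dimensional calculus (Mathlib's `NormedSpace.exp_analytic` in the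
`ℓ^∞`-operator normed algebra `Matrix n n ℂ`; entries ⟷ matrix by the standard basis and the entry functionals); theorem-only
(0 `def`).  HONEST FRAMING:
elementary; nothing of Bałaban's asserted; (D4) instance 0∕1; NOT BetaPertH, NOT continuum, NOT Clay.
-/
import Summits.QuantumFields.BalabanUV.Gaps.D4WalkBlockExpWindow
import Mathlib.Analysis.Normed.Module.FiniteDimension

/-!
# `Gaps.D4WalkBlockExpHolo` — holomorphy of `u ↦ e^{±X(u)}` entrywise from holomorphy of `u ↦ X(u)` entrywise
# (cell pub-balaban-gaps, seat g1-p2 gen 9)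

HONEST DEPENDENCY (cell pub-balaban, verbatim): continuum YM on T⁴ ⇐ BetaPertH ∧ nine spine estimates (0/9 proved);
BetaPertH ⇐ (D1) ∧ (D4) ∧ CAP+tail.

[B9] p. 407 (Cor. 3.5): *"G(U′) can be extended to an analytic function G(U) … on the space (3.37)"*; [II] p. 15: the kernels are
analytic functions of the background on the bigger space.  In the tree's Cor. 3.5 steps the background enters through the bond
field `U = e^{X}` (`X = iηA′`) and holomorphy of `u ↦ e^{±X(u)}` ENTRYWISE is a hypothesis (`D4WalkBlockExpTransport`, staged
`D4WalkBlockCovariantExpFieldMultiLevel.blockWalkExpansion_covariantGreenExp_multiLevelTorus`).  THIS FILE discharges it from the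
natural datum — holomorphy of the entries of `X`:
* §1 `matrix_eq_sum_smul_single`, **`differentiableOn_matrix_iff`** (a matrix-valued map on a
  finite index is holomorphic iff all its entries are; `ℓ^∞`-operator norm scope, any equivalent norm would do);
* §2 **`differentiableOn_exp_matrix`** (`exp ∘ X` holomorphic where `X` is: `NormedSpace.exp_analytic`), **`differentiableOn_exp_entry`**,
  **`differentiableOn_exp_neg_entry`** (the two hypothesis shapes of the Cor. 3.5 steps for `U = e^{X}`, `U⁻¹ = e^{−X}`), and the
  parametrised forms `differentiableOn_exp_entry_family` ∕ `differentiableOn_exp_neg_entry_family` (a bond field `X ν u y`).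
Value: bookkeeping; removes one hypothesis-datum from the `U = e^{X}` ENDs; words of row (D4) UNCHANGED.

References: T. Bałaban, Comm. Math. Phys. **99** (1985) 389–434 [B9], (3.37) p. 396, Cor. 3.5 p. 407; Comm. Math. Phys. **116** (1988)
1–22 [II], p. 15.
-/

noncomputable section

namespace Summit.QuantumFields.BalabanUV.Gaps.D4WalkBlockExpHolo

open Metric Set NormedSpace
open scoped Matrix

/-! ## §1. Matrix-valued holomorphy ⟷ entrywise holomorphy (finite index) -/

section MatrixCalculus

open scoped Matrix.Norms.Operator

variable {E : Type*} [NormedAddCommGroup E] [NormedSpace ℂ E]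
variable {m n : Type*} [Fintype m] [Fintype n] [DecidableEq m] [DecidableEq n]

omit [DecidableEq m] [DecidableEq n] in
/-- A matrix is the sum of its entries times the standard basis matrices (scalar form). -/
theorem matrix_eq_sum_smul_single (M : Matrix m n ℂ) [DecidableEq m] [DecidableEq n] :
    M = ∑ i, ∑ j, M i j • Matrix.single i j (1 : ℂ) := by
  conv_lhs => rw [Matrix.matrix_eq_sum_single M]
  refine Finset.sum_congr rfl fun i _ => Finset.sum_congr rfl fun j _ => ?_
  rw [Matrix.smul_single, smul_eq_mul, mul_one]

/-- **A matrix-valued map on a finite index is holomorphic on `s` iff all its entries are.** -/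
theorem differentiableOn_matrix_iff {X : E → Matrix m n ℂ} {s : Set E} :
    DifferentiableOn ℂ X s ↔ ∀ i j, DifferentiableOn ℂ (fun u => X u i j) s := by
  constructor
  · intro h i j
    -- entry evaluation is a continuous linear functional in finite dimensions
    exact fun u hu => (LinearMap.toContinuousLinearMap (Matrix.entryLinearMap ℂ ℂ i j) :
      Matrix m n ℂ →L[ℂ] ℂ).hasFDerivAt.differentiableAt.comp_differentiableWithinAt u (h u hu)
  · intro h
    have e : X = fun u => ∑ i, ∑ j, X u i j • Matrix.single i j (1 : ℂ) := by
      funext u; exact matrix_eq_sum_smul_single (X u)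
    rw [e]
    exact DifferentiableOn.fun_sum fun i _ => DifferentiableOn.fun_sum fun j _ => ((h i j).smul_const (Matrix.single i j (1 : ℂ)) :
      DifferentiableOn ℂ (fun u => X u i j • Matrix.single i j (1 : ℂ)) s)

end MatrixCalculus

/-! ## §2. Holomorphy of `u ↦ e^{±X(u)}` -/

section Exp

open scoped Matrix.Norms.Operator

variable {E : Type*} [NormedAddCommGroup E] [NormedSpace ℂ E]
variable {n : Type*} [Fintype n] [DecidableEq n]

/-- **`exp ∘ X` is holomorphic where `X` is** (matrix-valued; `NormedSpace.exp` is entire on the complete normed algebra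
`Matrix n n ℂ`). [cite: Balaban1985BackgroundPropagators, Cor. 3.5 p.407] -/
theorem differentiableOn_exp_matrix {X : E → Matrix n n ℂ} {s : Set E} (h : DifferentiableOn ℂ X s) :
    DifferentiableOn ℂ (fun u => exp (X u)) s := fun u hu =>
  ((exp_analytic (𝕂 := ℂ) (X u)).differentiableAt).comp_differentiableWithinAt u (h u hu)

/-- **ENTRYWISE: `u ↦ (e^{X(u)})_{ij}` is holomorphic on `s` when every entry `u ↦ X(u)_{ab}` is.**
[cite: Balaban1985BackgroundPropagators, Cor. 3.5 p.407, (3.37) p.396] -/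
theorem differentiableOn_exp_entry {X : E → Matrix n n ℂ} {s : Set E} (h : ∀ a b, DifferentiableOn ℂ (fun u => X u a b) s)
    (i j : n) : DifferentiableOn ℂ (fun u => exp (X u) i j) s :=
  (differentiableOn_matrix_iff.1 (differentiableOn_exp_matrix (differentiableOn_matrix_iff.2 h))) i j

/-- **ENTRYWISE, INVERSE TRANSPORTER: `u ↦ (e^{−X(u)})_{ij}` is holomorphic on `s` when every entry of `X` is.**
[cite: Balaban1985BackgroundPropagators, Cor. 3.5 p.407, (3.37) p.396] -/
theorem differentiableOn_exp_neg_entry {X : E → Matrix n n ℂ} {s : Set E} (h : ∀ a b, DifferentiableOn ℂ (fun u => X u a b) s)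
    (i j : n) : DifferentiableOn ℂ (fun u => exp (-X u) i j) s :=
  differentiableOn_exp_entry (X := fun u => -X u) (fun a b => (h a b).fun_neg) i j

/-- The parametrised form consumed by the Cor. 3.5 steps for `U = e^{X}`: a bond field `X ν u y` (axis `ν`, configuration `u`,
site `y`) with holomorphic entries on the ball gives holomorphic entries of `e^{X ν u y}`. [cite: Balaban1985BackgroundPropagators, Cor. 3.5 p.407] -/
theorem differentiableOn_exp_entry_family {ι S : Type*} {X : ι → E → S → Matrix n n ℂ} {Rb : ℝ}
    (h : ∀ ν y a b, DifferentiableOn ℂ (fun u => X ν u y a b) (ball (0 : E) Rb)) :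
    ∀ ν y a b, DifferentiableOn ℂ (fun u => exp (X ν u y) a b) (ball (0 : E) Rb) :=
  fun ν y a b => differentiableOn_exp_entry (X := fun u => X ν u y) (h ν y) a b

/-- The parametrised form for the inverse transporters `e^{−X ν u y}`. [cite: Balaban1985BackgroundPropagators, Cor. 3.5 p.407] -/
theorem differentiableOn_exp_neg_entry_family {ι S : Type*} {X : ι → E → S → Matrix n n ℂ} {Rb : ℝ}
    (h : ∀ ν y a b, DifferentiableOn ℂ (fun u => X ν u y a b) (ball (0 : E) Rb)) :
    ∀ ν y a b, DifferentiableOn ℂ (fun u => exp (-X ν u y) a b) (ball (0 : E) Rb) :=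
  fun ν y a b => differentiableOn_exp_neg_entry (X := fun u => X ν u y) (h ν y) a b

end Exp

end Summit.QuantumFields.BalabanUV.Gaps.D4WalkBlockExpHolo

end
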